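import Literature.AlgebraicGeometry.CossartJannsenSaito2020.DirectrixGenerization
import Literature.RingTheory.HilbertSamuel.DirectrixQuasiEtale
import HarnessLib

/-!
# Cossart–Jannsen–Saito (LNM 2270), Thm. 3.7 read intrinsically on `A = R/J`: `e(A_𝔮) + dim(A/𝔮) ≤ e(A)` for a
# permissible prime `𝔮` — KERNEL COROLLARY of the named fact `CossartJannsenSaito2020_thm_3_7` (F-64)

Source as in `DirectrixGenerization.lean`: CJS LNM 2270, Thm. 3.7, chunk p0044 L19–L21 of the held text (≈ printed p. 41 per lit/DIM3-INDEX §14; the F-64 reservation line wrote «p. 45») (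
`book:cossart2020-desingularization-invariants-strategy-application-dimension-2`). The printed statement
compares `e(R_𝔭/J_𝔭)` with `e(R/J)`; since localization commutes with quotients, `R_𝔭/J_𝔭 = (R/J)_{𝔭/J}`, so the theorem is a
statement about the local ring `A = R/J` and a prime `𝔮 = 𝔭/J ⊂ A`: `e(A_𝔮) + dim(A/𝔮) ≤ e(A)`. This file PROVES that reading
from the F-64 binder (Mathlib's `IsLocalization` instance for `R_𝔭 ⧸ J R_𝔭` over `R ⧸ J`, `IsLocalization.algEquiv`, the tree's
`dirDim_eq_of_ringEquiv`, `DoubleQuot.quotQuotEquivQuotOfLE`); no new fact. Requested with F-64 by the res-hironaka cell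
(rung L W4.2, consumers (K-ctr)/(c-geo)). The scheme-level Thm. 3.6 (with `dim 𝒪_{D,x}`) is NOT asserted here.
-/

noncomputable section

open IsLocalRing
open Literature.RingTheory.HilbertSamuel

namespace Literature.AlgebraicGeometry.CossartJannsenSaito2020

universe u

/-- For a prime `𝔮` of `R ⧸ J` and `𝔭 = 𝔮 ∩ R`, the image of `R ∖ 𝔭` in `R ⧸ J` is `(R ⧸ J) ∖ 𝔮`. [folklore] -/
private theorem algebraMapSubmonoid_primeCompl_comap_mk {R : Type u} [CommRing R] (J : Ideal R) (𝔮 : Ideal (R ⧸ J))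
    [𝔮.IsPrime] :
    Algebra.algebraMapSubmonoid (R ⧸ J) (𝔮.comap (Ideal.Quotient.mk J)).primeCompl = 𝔮.primeCompl := by
  ext x
  simp only [Algebra.algebraMapSubmonoid, Submonoid.mem_map, Ideal.mem_primeCompl_iff, Ideal.mem_comap,
    Ideal.Quotient.algebraMap_eq]
  constructor
  · rintro ⟨r, hr, rfl⟩
    exact hr
  · intro hx
    obtain ⟨r, rfl⟩ := Ideal.Quotient.mk_surjective x
    exact ⟨r, hx, rfl⟩

/-- **Thm 3.7 read intrinsically on `A = R/J`** (derived from the named fact): for a regular local ring `R`, an ideal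
`J` with `R/J` local, and a prime `𝔮 ⊂ A = R/J` with `Spec(A/𝔮) ⊂ Spec(A)` permissible (`Ideal.IsPermissible`), one has
`e(A_𝔮) + dim(A/𝔮) ≤ e(A)` — the localization `A_𝔮 = (R/J)_𝔮` being `R_𝔭/J_𝔭` for `𝔭 = 𝔮 ∩ R` (localization commutes
with quotients) and `A/𝔮 = R/𝔭`. Kernel corollary of `CossartJannsenSaito2020_thm_3_7` (taken as a hypothesis: D-0026).
[cite: CossartJannsenSaito2020, Thm. 3.7 (chunk p0044 L19–L21, ≈ p. 41)] -/
theorem dirDim_localization_add_ringKrullDim_le (h37 : CossartJannsenSaito2020_thm_3_7.{u})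
    {R : Type u} [CommRing R] [IsRegularLocalRing R] (J : Ideal R) [IsLocalRing (R ⧸ J)]
    (𝔮 : Ideal (R ⧸ J)) [𝔮.IsPrime] (h𝔮 : 𝔮.IsPermissible) :
    (dirDim (Localization.AtPrime 𝔮) : WithBot ℕ∞) + ringKrullDim ((R ⧸ J) ⧸ 𝔮) ≤ (dirDim (R ⧸ J) : WithBot ℕ∞) := by
  set 𝔭 : Ideal R := 𝔮.comap (Ideal.Quotient.mk J) with h𝔭def
  have hJ𝔭 : J ≤ 𝔭 := fun r hr => by
    show Ideal.Quotient.mk J r ∈ 𝔮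
    rw [Ideal.Quotient.eq_zero_iff_mem.mpr hr]
    exact 𝔮.zero_mem
  have hmap : 𝔭.map (Ideal.Quotient.mk J) = 𝔮 := Ideal.map_comap_of_surjective _ Ideal.Quotient.mk_surjective 𝔮
  -- `S = R_𝔭 / J R_𝔭` is the localization of `R/J` at `𝔮`
  set S := Localization.AtPrime 𝔭 ⧸ J.map (algebraMap R (Localization.AtPrime 𝔭)) with hSdef
  haveI : IsLocalization.AtPrime S 𝔮 := by
    have h := algebraMapSubmonoid_primeCompl_comap_mk J 𝔮
    rw [IsLocalization.AtPrime, ← h]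
    infer_instance
  haveI : IsLocalRing S := IsLocalization.AtPrime.isLocalRing S 𝔮
  have e : S ≃ₐ[R ⧸ J] Localization.AtPrime 𝔮 := IsLocalization.algEquiv 𝔮.primeCompl S (Localization.AtPrime 𝔮)
  have hdir : dirDim (Localization.AtPrime 𝔮) = dirDim S := dirDim_eq_of_ringEquiv e.toRingEquiv
  have eq : ((R ⧸ J) ⧸ 𝔮) ≃+* R ⧸ 𝔭 := (Ideal.quotEquivOfEq hmap.symm).trans (DoubleQuot.quotQuotEquivQuotOfLE hJ𝔭)
  have hdim : ringKrullDim ((R ⧸ J) ⧸ 𝔮) = ringKrullDim (R ⧸ 𝔭) := ringKrullDim_eq_of_ringEquiv eq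
  rw [hdir, hdim]
  exact h37 R J 𝔭 hJ𝔭 (hmap.symm ▸ h𝔮)

end Literature.AlgebraicGeometry.CossartJannsenSaito2020

end
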